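import Literature.Analysis.FluidPDE.TorusWeakNSGluing
import Literature.Analysis.FluidPDE.PassiveScalarForcedClass

/-!
# Gluing weak sourced passive scalars in time at an `L²`-trace time

Summit-side helper file (everything proved) for the `2½`-dimensional scalar lift
(`Summit.AnomalousDissipation.AnomalousDissipation.Theses.TwoAndHalfD.ScalarLift2halfDR`): the
scalar counterpart of the tree's gluing of weak Navier–Stokes solutions
(`Literature/Analysis/FluidPDE/TorusWeakNSGluing`). If `θ₁` is a weak sourced scalar on
`[0, T₁)` (`Torus.IsWeakScalarTransportForcedOn`, drift `u`, source `s`, datum `θ₀`) satisfying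
the time-sliced weak identity at the time `σ ∈ (0, T₁)` for every smooth space–time field (the
`L²` trace identity, valid at a.e. `σ`; file `…Trace`), and `Θ` is a global weak sourced scalar
from the datum `θ₁ σ` over the translated drift `u(· + σ)` and source `s(· + σ)`, then
`t ↦ θ₁ t` (`t ≤ σ`), `Θ (t - σ)` (`t > σ`) is a global weak sourced scalar from `θ₀`
(`isWeakScalarTransportForced_glue`, file `…Glue`). This first file holds the tools: restriction of
the horizon and congruence of the sourced class, a smooth time cutoff of a globally smooth field
to a test on `[0, T)`, splitting `(0, T)` at `σ` and translating, and the space–time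
measurability of a glued field.
-/

noncomputable section

open MeasureTheory Set Filter Topology Function UnitAddTorus
open scoped ENNReal NNReal InnerProductSpace ContDiff
open Literature.Analysis.FunctionSpaces Literature.Analysis.FunctionSpaces.Torus
open Literature.Analysis.FluidPDE Literature.Analysis.FluidPDE.Torus

namespace Summit.AnomalousDissipation.AnomalousDissipation.Theorems

set_option linter.dupNamespace false

section Glue

variable {d : Type*} [Fintype d]
variable {T κ : ℝ} {u : ℝ → UnitAddTorus d → EuclideanSpace ℝ d} {s : ℝ → UnitAddTorus d → ℝ}
  {θ₀ : UnitAddTorus d → ℝ} {θ : ℝ → UnitAddTorus d → ℝ}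

/-! ### Calculus of test fields -/

/-- The gradient of the zero scalar on `T^d` vanishes. [folklore] -/
theorem gradient_zero_real (y : UnitAddTorus d) : Torus.gradient (0 : UnitAddTorus d → ℝ) y = 0 := by
  unfold Torus.gradient Torus.liftAt
  simp [_root_.gradient]

/-- The Laplacian of the zero scalar on `T^d` vanishes. [folklore] -/
theorem laplacian_zero_real (y : UnitAddTorus d) : Torus.laplacian (0 : UnitAddTorus d → ℝ) y = 0 := by
  unfold Torus.laplacian Torus.liftAt
  simp

/-- **Smooth cutoff of a globally smooth field to a test on `[0, T)` that is unchanged before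
`a < T`** (multiply by `smoothTransition ((b - t)/(b - a))`, `b = (a + T)/2`). [folklore] -/
theorem exists_isSpaceTimeTest_eq_of_lt {T a : ℝ} (haT : a < T) {ψ : ℝ → UnitAddTorus d → ℝ}
    (hψ : ContDiff ℝ ∞ (stLift ψ)) :
    ∃ ψ' : ℝ → UnitAddTorus d → ℝ, IsSpaceTimeTest T ψ' ∧
      ∀ t < a, ψ' t = ψ t ∧ ∀ x, Torus.timeDeriv ψ' t x = Torus.timeDeriv ψ t x := by
  set b : ℝ := (a + T) / 2 with hb
  have hab : a < b := by rw [hb]; linarith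
  have hbT : b < T := by rw [hb]; linarith
  set χ : ℝ → ℝ := fun t => Real.smoothTransition ((b - t) / (b - a)) with hχ
  have hχs : ContDiff ℝ ∞ χ :=
    Real.smoothTransition.contDiff.comp ((contDiff_const.sub contDiff_id).div_const _)
  have hχ1 : ∀ t < a, ∀ᶠ t' in 𝓝 t, χ t' = 1 := by
    intro t ht
    filter_upwards [Iio_mem_nhds ht] with t' ht'
    apply Real.smoothTransition.one_of_one_le
    rw [le_div_iff₀ (by linarith)]
    linarith [mem_Iio.1 ht']
  have hχ0 : ∀ t, b ≤ t → χ t = 0 := fun t ht =>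
    Real.smoothTransition.zero_of_nonpos (div_nonpos_of_nonpos_of_nonneg (by linarith) (by linarith))
  refine ⟨fun t x => χ t * ψ t x, ⟨?_, b, hbT, fun t ht => funext fun x => by simp [hχ0 t ht]⟩,
    fun t ht => ?_⟩
  · have e : stLift (fun t x => χ t * ψ t x) = fun p : ℝ × EuclideanSpace ℝ d => χ p.1 * stLift ψ p := by
      funext p; rfl
    rw [e]
    exact (hχs.comp contDiff_fst).mul hψ
  · have hχt : χ t = 1 := (hχ1 t ht).self_of_nhds
    refine ⟨funext fun x => by simp [hχt], fun x => ?_⟩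
    simp only [Torus.timeDeriv]
    refine Filter.EventuallyEq.deriv_eq ?_
    filter_upwards [hχ1 t ht] with t' ht'
    simp [ht']

/-! ### Restriction of the horizon and congruence for the sourced class -/

/-- **Restriction of the horizon**: a weak sourced scalar on `[0, T₁)` is one on `[0, T)` for
`T ≤ T₁` (a test on `[0, T)` is a test on `[0, T₁)` whose weak integrands vanish on `[T, T₁)`).
[folklore] -/
theorem isWeakScalarTransportForcedOn_of_le {T₁ : ℝ} (h : IsWeakScalarTransportForcedOn T₁ κ u s θ₀ θ)
    (hT : T ≤ T₁) : IsWeakScalarTransportForcedOn T κ u s θ₀ θ := by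
  have hIoo : Ioo (0 : ℝ) T ⊆ Ioo 0 T₁ := Ioo_subset_Ioo_right hT
  have hμ : volume.restrict (Ioo (0 : ℝ) T) ≤ volume.restrict (Ioo 0 T₁) := Measure.restrict_mono hIoo le_rfl
  have hμ2 : volume.restrict (Ioo (0 : ℝ) T ×ˢ (univ : Set (EuclideanSpace ℝ d))) ≤
      volume.restrict (Ioo 0 T₁ ×ˢ univ) := Measure.restrict_mono (prod_mono hIoo subset_rfl) le_rfl
  obtain ⟨C, hC⟩ := h.ae_lintegral_sq_le
  refine ⟨h.aestronglyMeasurable.mono_measure hμ2, h.aestronglyMeasurable_velocity.mono_measure hμ2,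
    h.aestronglyMeasurable_source.mono_measure hμ2, ⟨C, ae_mono hμ hC⟩,
    (lintegral_mono_set hIoo).trans_lt h.lintegral_velocity_lt_top,
    (lintegral_mono_set hIoo).trans_lt h.lintegral_mul_lt_top,
    (lintegral_mono_set hIoo).trans_lt h.lintegral_source_lt_top,
    ae_mono hμ h.ae_isWeaklyDivFree, fun ψ hψ => ?_⟩
  obtain ⟨T', hT'T, hψ0⟩ := hψ.2
  have key := h.weak_eq ψ (hψ.of_le hT)
  -- the weak integrands vanish on `[T, T₁)`
  have hdt : ∀ t, T ≤ t → ∀ x, Torus.timeDeriv ψ t x = 0 := by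
    intro t ht x
    have he : (fun τ => ψ τ x) =ᶠ[𝓝 t] fun _ => (0 : ℝ) := by
      filter_upwards [Ioi_mem_nhds (hT'T.trans_le ht)] with τ hτ
      rw [hψ0 τ (le_of_lt hτ), Pi.zero_apply]
    change deriv (fun τ => ψ τ x) t = 0
    rw [he.deriv_eq, deriv_const]
  have h1 : ∫ t in Ioo 0 T₁, ∫ x, θ t x * (Torus.timeDeriv ψ t x + ⟪u t x, Torus.gradient (ψ t) x⟫_ℝ +
      κ * Torus.laplacian (ψ t) x) = ∫ t in Ioo 0 T, ∫ x, θ t x * (Torus.timeDeriv ψ t x +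
      ⟪u t x, Torus.gradient (ψ t) x⟫_ℝ + κ * Torus.laplacian (ψ t) x) := by
    refine setIntegral_eq_of_subset_of_forall_sdiff_eq_zero measurableSet_Ioo hIoo fun t ht => ?_
    have htT : T ≤ t := by
      by_contra hlt
      exact ht.2 ⟨ht.1.1, not_le.1 hlt⟩
    simp [hdt t htT, hψ0 t (hT'T.le.trans htT), gradient_zero_real, laplacian_zero_real]
  have h2 : ∫ t in Ioo 0 T₁, ∫ x, s t x * ψ t x = ∫ t in Ioo 0 T, ∫ x, s t x * ψ t x := by
    refine setIntegral_eq_of_subset_of_forall_sdiff_eq_zero measurableSet_Ioo hIoo fun t ht => ?_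
    have htT : T ≤ t := by
      by_contra hlt
      exact ht.2 ⟨ht.1.1, not_le.1 hlt⟩
    simp [hψ0 t (hT'T.le.trans htT)]
  rw [h1, h2] at key
  exact key

/-- **Congruence on `(0, T)`**: the sourced class only sees the slices `θ t`, `t ∈ (0, T)`. [folklore] -/
theorem isWeakScalarTransportForcedOn_congr {θ' : ℝ → UnitAddTorus d → ℝ}
    (h : IsWeakScalarTransportForcedOn T κ u s θ₀ θ) (heq : ∀ t ∈ Ioo 0 T, θ' t = θ t) :
    IsWeakScalarTransportForcedOn T κ u s θ₀ θ' := by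
  have hae : ∀ᵐ p ∂(volume.restrict (Ioo (0 : ℝ) T ×ˢ (univ : Set (EuclideanSpace ℝ d)))),
      stLift θ p = stLift θ' p := by
    filter_upwards [ae_restrict_mem (measurableSet_Ioo.prod MeasurableSet.univ)] with p hp
    simp only [stLift, heq p.1 hp.1]
  obtain ⟨C, hC⟩ := h.ae_lintegral_sq_le
  refine ⟨h.aestronglyMeasurable.congr hae, h.aestronglyMeasurable_velocity, h.aestronglyMeasurable_source,
    ⟨C, ?_⟩, h.lintegral_velocity_lt_top, ?_, h.lintegral_source_lt_top, h.ae_isWeaklyDivFree,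
    fun ψ hψ => ?_⟩
  · filter_upwards [hC, ae_restrict_mem measurableSet_Ioo] with t ht htI
    simpa only [heq t htI] using ht
  · calc ∫⁻ t in Ioo 0 T, ∫⁻ x, ‖u t x‖ₑ * ‖θ' t x‖ₑ = ∫⁻ t in Ioo 0 T, ∫⁻ x, ‖u t x‖ₑ * ‖θ t x‖ₑ :=
          setLIntegral_congr_fun measurableSet_Ioo fun t ht => by simp only [heq t ht]
      _ < ⊤ := h.lintegral_mul_lt_top
  · have e : ∫ t in Ioo 0 T, ∫ x, θ' t x * (Torus.timeDeriv ψ t x + ⟪u t x, Torus.gradient (ψ t) x⟫_ℝ +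
        κ * Torus.laplacian (ψ t) x) = ∫ t in Ioo 0 T, ∫ x, θ t x * (Torus.timeDeriv ψ t x +
        ⟪u t x, Torus.gradient (ψ t) x⟫_ℝ + κ * Torus.laplacian (ψ t) x) :=
      setIntegral_congr_fun measurableSet_Ioo fun t ht => by simp only [heq t ht]
    rw [e]
    exact h.weak_eq ψ hψ

/-! ### Splitting `(0, T)` at `σ` and translating -/

omit [Fintype d] in
/-- An a.e. statement on `(0, T)` from its pieces on `(0, σ]` and `(σ, T)`. [folklore] -/
theorem ae_restrict_Ioo_of_split {σ : ℝ} (hσ0 : 0 ≤ σ) (hσT : σ < T) {P : ℝ → Prop}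
    (h1 : ∀ᵐ t ∂(volume.restrict (Ioc 0 σ)), P t) (h2 : ∀ᵐ t ∂(volume.restrict (Ioo σ T)), P t) :
    ∀ᵐ t ∂(volume.restrict (Ioo 0 T)), P t := by
  rw [← Ioc_union_Ioo_eq_Ioo hσ0 hσT, ae_restrict_union_iff]
  exact ⟨h1, h2⟩

omit [Fintype d] in
/-- A lower integral over `(0, T)` is finite if it is over `(0, σ]` and `(σ, T)`. [folklore] -/
theorem setLIntegral_Ioo_lt_top_of_split {σ : ℝ} (hσ0 : 0 ≤ σ) (hσT : σ < T) {G : ℝ → ℝ≥0∞}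
    (h1 : ∫⁻ t in Ioc 0 σ, G t < ⊤) (h2 : ∫⁻ t in Ioo σ T, G t < ⊤) : ∫⁻ t in Ioo 0 T, G t < ⊤ := by
  rw [← Ioc_union_Ioo_eq_Ioo hσ0 hσT]
  exact (lintegral_union_le _ _ _).trans_lt (ENNReal.add_lt_top.2 ⟨h1, h2⟩)

omit [Fintype d] in
/-- Integrability over `(σ, T)` of `t ↦ F (t - σ)` from integrability of `F` over `(0, T - σ)`.
[folklore] -/
theorem integrableOn_Ioo_comp_sub_right {F : ℝ → ℝ} {σ : ℝ} (hF : IntegrableOn F (Ioo 0 (T - σ))) :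
    IntegrableOn (fun t => F (t - σ)) (Ioo σ T) := by
  have h := (measurePreserving_sub_right_Ioo σ T).integrable_comp_emb
    (MeasurableEquiv.subRight σ).measurableEmbedding (g := F)
  exact h.2 hF

/-- **Space–time measurability of a glued field** from measurability of the pieces on
`(0, σ] × T^d` and `(0, T - σ) × T^d`. [folklore] -/
theorem aestronglyMeasurable_stLift_glue' {F : Type*} [NormedAddCommGroup F] {σ : ℝ} (hσ0 : 0 ≤ σ) (hσT : σ < T)
    {v w : ℝ → UnitAddTorus d → F}
    (hv : AEStronglyMeasurable (stLift v) (volume.restrict (Ioc 0 σ ×ˢ univ)))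
    (hw : AEStronglyMeasurable (stLift w) (volume.restrict (Ioo 0 (T - σ) ×ˢ univ))) :
    AEStronglyMeasurable (stLift fun t => if t ≤ σ then v t else w (t - σ))
      (volume.restrict (Ioo 0 T ×ˢ (univ : Set (EuclideanSpace ℝ d)))) := by
  set A : Set (ℝ × EuclideanSpace ℝ d) := {p | p.1 ≤ σ} with hA
  have hAm : MeasurableSet A := measurableSet_le measurable_fst measurable_const
  have hdec : (stLift fun t => if t ≤ σ then v t else w (t - σ)) =
      A.indicator (stLift v) + Aᶜ.indicator (stLift fun t => w (t - σ)) := by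
    funext p
    obtain ⟨t, y⟩ := p
    by_cases ht : t ≤ σ
    · have hp : (t, y) ∈ A := ht
      simp [stLift, ht, indicator_of_mem hp, indicator_of_notMem (notMem_compl_iff.2 hp)]
    · have hp : (t, y) ∉ A := ht
      simp [stLift, ht, indicator_of_notMem hp, indicator_of_mem (mem_compl hp)]
  rw [hdec]
  refine AEStronglyMeasurable.add ?_ ?_
  · rw [aestronglyMeasurable_indicator_iff hAm, Measure.restrict_restrict hAm]
    have hset : A ∩ Ioo 0 T ×ˢ (univ : Set (EuclideanSpace ℝ d)) = Ioc 0 σ ×ˢ univ := by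
      ext p
      obtain ⟨t, y⟩ := p
      simp only [hA, mem_inter_iff, mem_setOf_eq, mem_prod, mem_Ioo, mem_Ioc, mem_univ, and_true]
      constructor
      · rintro ⟨h1, h2, -⟩
        exact ⟨h2, h1⟩
      · rintro ⟨h1, h2⟩
        exact ⟨h2, h1, h2.trans_lt hσT⟩
    rwa [hset]
  · rw [aestronglyMeasurable_indicator_iff hAm.compl, Measure.restrict_restrict hAm.compl]
    have hset : Aᶜ ∩ Ioo 0 T ×ˢ (univ : Set (EuclideanSpace ℝ d)) = Ioo σ T ×ˢ univ := by
      ext p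
      obtain ⟨t, y⟩ := p
      simp only [hA, mem_inter_iff, mem_compl_iff, mem_setOf_eq, not_le, mem_prod, mem_Ioo, mem_univ,
        and_true]
      constructor
      · rintro ⟨h1, -, h3⟩
        exact ⟨h1, h3⟩
      · rintro ⟨h1, h2⟩
        exact ⟨h1, hσ0.trans_lt h1, h2⟩
    rw [hset]
    have hg : (stLift fun t => w (t - σ)) = stLift w ∘ Prod.map (fun t : ℝ => t - σ) id := by
      funext p
      rfl
    rw [hg]
    exact hw.comp_measurePreserving (measurePreserving_prodMap_sub_right_Ioo σ T)

end Glue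

end Summit.AnomalousDissipation.AnomalousDissipation.Theorems

end
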